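import Summits.QuantumFields.YangMills.Theorems.DiagonalMirrorRPRTwoShiftExtraction
import Summits.QuantumFields.YangMills.Theorems.DiagonalMirrorRPRFamObsGrowth
import Summits.QuantumFields.YangMills.Theorems.DiagonalMirrorRPROddTorusSwapPairingDefs
import Summits.QuantumFields.YangMills.Theorems.DiagonalMirrorRPRSignTwistedCore

/-!
# Crux `WeakCouplingHypercubicLimitRP` (stmt-QuantumFields-27398) / aside `DiagonalMirrorRPR` (stmt-QuantumFields-10604), door B, letter R1 RETYPED:
# the super-logarithmic torus-scale odd gap `OddLogGap` and the core re-run `core_of_logGap` (card #120 `odd-log-gap-retype`, PASS) — re-homed, sorry-free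

Helper file (`--supports stmt-QuantumFields-27398 --as helper`) of the hand `hand-10604-wilsonDiagModel-3` g0, docket director-ym g24 O4 WORD 42 (1)(b)
(idea-crit-9 g13 verdict #120: second package of record {R1♮ `OddLogGap`, R2 `DiagLukewarm`}): LAND §3 of the crux-ideate seat «spectral-transfer» g2
(`pub/ym-o4cluster/cruxidea-10604-r2/spectral-transfer/Sketch-spectral-transfer-g2.lean`, sha16 `4e9ac7c070738e84`) VERBATIM, in BINDER form, in the
door-B namespace `…Cruxes.DiagonalMirrorRPR.SignTwistedDiagonalTrace`.  Bodies and docstrings are the seat's, byte-for-byte.  It closes nothing by itself.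

* `OddLogGap 𝔪` — R1♮: the `U`-odd sector lies below `exp(−M_k/side_k)·λ₀(k)` with `M_k / log side_k → ∞`;
* `tendsto_side_atTop`, `tendsto_M_atTop`, `tendsto_penalty_zero_log` — scheme asymptotics and the variable-rate penalty;
* ★ `core_of_logGap : OddLogGap 𝔪 → DiagLukewarm 𝔪 → Growth r sch → OddTorusSwapPairingLiminf r sch` — the landed core `core_of` re-run on R1♮;
* `oddLogGap_of_oddTwistGap` (under `SideGrowth`), `oddLogGap_of_coarseGap` (from the torus-scale letter `CoarseGap` of `…TwoShiftExtraction` ALONE),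
  `oddTorusSwapPairingLiminf_of_logGapLetters` (the `∃ 𝔪` packaging).
Under R2 the R1 residue of door B is therefore EXACTLY the torus-scale band `(log side_k)/side_k`, from both sides (g13 #120).

HONEST FRAMING: re-homing of proved reductions; NO letter is proved for Wilson's model; R1♮∕R2, D1′, S6i, ⟨27398⟩ (0∕2) and the aside ⟨10604⟩ are
OPEN; nothing here bears on the summit; the Yang–Mills mass gap is NOT proved here or anywhere in the tree.  One `Prop`-valued predicate on a model
binder (`OddLogGap`), no instance, no notation, `autoImplicit false`.

References: Osterwalder–Seiler, Ann. Phys. 110 (1978) §2–3; Fröhlich–Israel–Lieb–Simon, Comm. Math. Phys. 62 (1978) Thm 2.1; Seiler LNP 159 Ch. 2.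
-/

set_option autoImplicit false

noncomputable section

open scoped SchwartzMap
open MeasureTheory Filter Topology
open Literature.MathematicalPhysics.QuantumLattice Literature.MathematicalPhysics.AQFT
  Literature.MathematicalPhysics.QuantumFieldTheory

namespace Summit.QuantumFields.YangMills.Cruxes.DiagonalMirrorRPR.SignTwistedDiagonalTrace

/-! ## §3 R1 retyped to what the core consumes: the super-logarithmic torus-scale odd gap `OddLogGap` (PROVED re-run of `core_of`) -/

section LogGap

variable {G : Type} [Group G] [TopologicalSpace G] [IsTopologicalGroup G] [CompactSpace G]
  [MeasurableSpace G] [BorelSpace G] {r : LatticeRep G} {sch : SpeciesScheme (YMSpecies G)}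

/-- **R1♮ `OddLogGap`** (what `core_of` actually consumes of R1, given R2 `DiagLukewarm`): the `U`-odd sector lies below
`exp(−M_k/side_k)·λ₀(k)` with `M_k / log side_k → ∞` — a gap just ABOVE THE TORUS SCALE in lattice units (`M_k/side_k = (M_k/ℓ_k)·a_k`, physical
rate `M_k/ℓ_k → 0` allowed), instead of R1's physical-scale `γ·a_k`.  `OddTwistGap ⇒ OddLogGap` with `M_k = γ a_k side_k` (`a_k side_k / log side_k → ∞`
by `SideGrowth`); the converse fails. -/
def OddLogGap (𝔪 : DiagonalSliceModel r sch) : Prop :=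
  ∃ M : ℕ → ℝ, Tendsto (fun k => M k / Real.log (sch.side k)) atTop atTop ∧
    ∀ᶠ k in atTop, ∀ j, 𝔪.sm k j ≤ Real.exp (-(M k / sch.side k)) * 𝔪.top k

omit [TopologicalSpace G] [IsTopologicalGroup G] [CompactSpace G] [BorelSpace G] in
/-- `side_k → ∞`. -/
theorem tendsto_side_atTop (sch : SpeciesScheme (YMSpecies G)) : Tendsto (fun k => (sch.side k : ℝ)) atTop atTop := by
  have hx := tendsto_a_mul_side' sch
  have ha1 : ∀ᶠ k in atTop, sch.a k ≤ 1 :=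
    ((tendsto_order.1 sch.tendsto_a).2 1 one_pos).mono fun k hk => hk.le
  refine tendsto_atTop_mono' atTop ?_ hx
  filter_upwards [ha1] with k hk
  exact mul_le_of_le_one_left (Nat.cast_nonneg _) hk

omit [TopologicalSpace G] [IsTopologicalGroup G] [CompactSpace G] [BorelSpace G] in
/-- A super-logarithmic `M` tends to `+∞`. -/
theorem tendsto_M_atTop (sch : SpeciesScheme (YMSpecies G)) {M : ℕ → ℝ}
    (hM : Tendsto (fun k => M k / Real.log (sch.side k)) atTop atTop) : Tendsto M atTop atTop := by
  have hlog : Tendsto (fun k => Real.log (sch.side k : ℝ)) atTop atTop := Real.tendsto_log_atTop.comp (tendsto_side_atTop sch)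
  refine tendsto_atTop_mono' atTop ?_ hM
  filter_upwards [hlog.eventually_ge_atTop 1, hM.eventually_ge_atTop 0] with k hl hM0
  have hMk : 0 ≤ M k := by
    have := mul_nonneg hM0 (zero_le_one.trans hl)
    rwa [div_mul_cancel₀ _ (by linarith : Real.log (sch.side k : ℝ) ≠ 0)] at this
  exact div_le_self hMk hl

omit [TopologicalSpace G] [IsTopologicalGroup G] [CompactSpace G] [BorelSpace G] in
/-- **Variable-rate penalty (PROVED):** `K (a⁻¹)^P (a·side)^Q e^{−c M_k} → 0` whenever `M_k / log side_k → ∞` — polynomial prefactors in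
`side_k ≥ a_k⁻¹, a_k side_k` are `exp(O(log side_k))`. -/
theorem tendsto_penalty_zero_log (sch : SpeciesScheme (YMSpecies G)) {M : ℕ → ℝ}
    (hM : Tendsto (fun k => M k / Real.log (sch.side k)) atTop atTop) (K c : ℝ) (hc : 0 < c) (P Q : ℕ) :
    Tendsto (fun k => K * ((sch.a k)⁻¹ ^ P * (sch.a k * sch.side k) ^ Q * Real.exp (-(c * M k)))) atTop (𝓝 0) := by
  have hx := tendsto_a_mul_side' sch
  have hS := tendsto_side_atTop sch
  have hlog : Tendsto (fun k => Real.log (sch.side k : ℝ)) atTop atTop := Real.tendsto_log_atTop.comp hS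
  have ha1 : ∀ᶠ k in atTop, sch.a k ≤ 1 :=
    ((tendsto_order.1 sch.tendsto_a).2 1 one_pos).mono fun k hk => hk.le
  -- the comparison sequence `|K| · exp((P+Q) log side − c M) → 0`
  have hexpo : Tendsto (fun k => ((P + Q : ℕ) : ℝ) * Real.log (sch.side k : ℝ) - c * M k) atTop atBot := by
    have h1 : Tendsto (fun k => ((P + Q : ℕ) : ℝ) - c * (M k / Real.log (sch.side k : ℝ))) atTop atBot := by
      have := tendsto_neg_atTop_atBot.comp (hM.const_mul_atTop hc)
      simpa [sub_eq_add_neg] using tendsto_atBot_add_const_left atTop (((P + Q : ℕ) : ℝ)) this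
    have h2 := hlog.atTop_mul_atBot₀ h1
    refine h2.congr' ?_
    filter_upwards [hlog.eventually_ge_atTop 1] with k hl
    have hl0 : Real.log (sch.side k : ℝ) ≠ 0 := by linarith
    field_simp
  have hcmp : Tendsto (fun k => |K| * Real.exp (((P + Q : ℕ) : ℝ) * Real.log (sch.side k : ℝ) - c * M k)) atTop (𝓝 0) := by
    have := (Real.tendsto_exp_atBot.comp hexpo).const_mul |K|
    simpa using this
  refine squeeze_zero_norm' ?_ hcmp
  filter_upwards [ha1, hx.eventually_ge_atTop 1, hS.eventually_ge_atTop 1] with k ha1k hx1 hS1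
  have ha0 : 0 < sch.a k := sch.a_pos k
  have hS0 : (0 : ℝ) < sch.side k := by linarith
  -- `a⁻¹ ≤ side`, `a side ≤ side`
  have hinv : (sch.a k)⁻¹ ≤ (sch.side k : ℝ) := by
    calc (sch.a k)⁻¹ = (sch.a k)⁻¹ * 1 := by ring
      _ ≤ (sch.a k)⁻¹ * (sch.a k * sch.side k) := mul_le_mul_of_nonneg_left hx1 (inv_nonneg.2 ha0.le)
      _ = sch.side k := by field_simp
  have has : sch.a k * sch.side k ≤ (sch.side k : ℝ) := mul_le_of_le_one_left hS0.le ha1k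
  have hP : (sch.a k)⁻¹ ^ P ≤ (sch.side k : ℝ) ^ P := pow_le_pow_left₀ (inv_nonneg.2 ha0.le) hinv P
  have hQ : (sch.a k * sch.side k) ^ Q ≤ (sch.side k : ℝ) ^ Q := pow_le_pow_left₀ (by positivity) has Q
  have hpow : (sch.side k : ℝ) ^ P * (sch.side k : ℝ) ^ Q = Real.exp (((P + Q : ℕ) : ℝ) * Real.log (sch.side k : ℝ)) := by
    rw [← pow_add, Real.exp_nat_mul, Real.exp_log hS0]
  rw [Real.norm_eq_abs, abs_mul]
  refine mul_le_mul_of_nonneg_left ?_ (abs_nonneg K)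
  rw [abs_of_nonneg (by positivity), Real.exp_sub, ← hpow, div_eq_mul_inv, ← Real.exp_neg]
  have hE : 0 ≤ Real.exp (-(c * M k)) := (Real.exp_pos _).le
  calc (sch.a k)⁻¹ ^ P * (sch.a k * sch.side k) ^ Q * Real.exp (-(c * M k))
      ≤ (sch.side k : ℝ) ^ P * (sch.side k : ℝ) ^ Q * Real.exp (-(c * M k)) := by
        refine mul_le_mul_of_nonneg_right ?_ hE
        exact mul_le_mul hP hQ (by positivity) (by positivity)
    _ = (sch.side k : ℝ) ^ P * (sch.side k : ℝ) ^ Q * Real.exp (-(c * M k)) := rfl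

set_option maxHeartbeats 1600000 in
/-- **`core_of_logGap` (PROVED — R1 retyped):** the landed core `core_of` (✓ `…DiagonalMirrorRPRSignTwistedCore`) re-run with the torus-scale
letter `OddLogGap` in place of `OddTwistGap`.  R1's rate entered `core_of` only through `C g^{S−2t} ≤ 1/2` and the penalty
`2 C B_k² g^{S−2d−2t} → 0` against the polynomial sup-norm growth `B_k = K a_k^{−P} (a_k side_k)^Q`; with `g_k = exp(−M_k/side_k)` both exponents are
`≥ (1−2θ) M_k / 2`, and `poly(side_k)·e^{−(1−2θ)M_k/2} → 0` exactly when `M_k / log side_k → ∞` (`tendsto_penalty_zero_log`). -/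
theorem core_of_logGap (𝔪 : DiagonalSliceModel r sch) (hR1 : OddLogGap 𝔪) (hR2 : DiagLukewarm 𝔪) (hG : Growth r sch) :
    OddTorusSwapPairingLiminf r sch := by
  intro m n c f σf hf _hdisj hσ
  let F : ReflectedFamily :=
    ⟨m, n, c, f, σf, fun i j => (hf i j).1, fun i j => (hf i j).2, hσ⟩
  change 0 ≤ Filter.liminf (fun k => gramPairing r sch F k) atTop
  obtain ⟨M, hM, hgap⟩ := hR1
  obtain ⟨θ, hθ0, hθ, C, hluke⟩ := hR2
  obtain ⟨R, hR⟩ := 𝔪.depth_le F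
  obtain ⟨K, P, Q, hB⟩ := famObs_supGrowth hG.1 F
  -- asymptotics of the scheme
  have hx : Tendsto (fun k => sch.a k * (sch.side k : ℝ)) atTop atTop := tendsto_a_mul_side' sch
  have ha1 : ∀ᶠ k in atTop, sch.a k ≤ 1 :=
    ((tendsto_order.1 sch.tendsto_a).2 1 one_pos).mono fun k hk => hk.le
  have hSinf : Tendsto (fun k => (sch.side k : ℝ)) atTop atTop := tendsto_side_atTop sch
  have hMinf : Tendsto M atTop atTop := tendsto_M_atTop sch hM
  have h12θ : 0 < 1 - 2 * θ := by linarith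
  -- the surviving exponent rate `cθ = (1 − 2θ)/2`
  set cθ : ℝ := (1 - 2 * θ) / 2 with hcθ_def
  have hcθ : 0 < cθ := by rw [hcθ_def]; positivity
  -- the penalty sequence
  let ε : ℕ → ℝ := fun k => (2 * C) * (K ^ 2 * ((sch.a k)⁻¹ ^ (2 * P) *
    (sch.a k * sch.side k) ^ (2 * Q) * Real.exp (-(cθ * M k))))
  have hε : Tendsto ε atTop (𝓝 0) := by
    have := (tendsto_penalty_zero_log sch hM (K ^ 2) cθ hcθ (2 * P) (2 * Q)).const_mul (2 * C)
    rw [mul_zero] at this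
    exact this
  refine liminf_nonneg_of_eventually_ge hε ?_
  -- eventual side conditions
  have hS1 : ∀ᶠ k in atTop, 1 ≤ θ * (sch.side k : ℝ) := (hSinf.const_mul_atTop hθ0).eventually_ge_atTop 1
  have hroom : ∀ᶠ k in atTop, 4 * R + 4 ≤ (1 - 2 * θ) * (sch.a k * sch.side k) :=
    (hx.const_mul_atTop h12θ).eventually_ge_atTop _
  have hM0 : ∀ᶠ k in atTop, 0 ≤ M k := hMinf.eventually_ge_atTop 0
  have hhalf : ∀ᶠ k in atTop, C * Real.exp (-(cθ * M k)) ≤ 1 / 2 := by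
    have h2 : Tendsto (fun k => C * Real.exp (-(cθ * M k))) atTop (𝓝 (C * 0)) :=
      (Real.tendsto_exp_atBot.comp (tendsto_neg_atTop_atBot.comp (hMinf.const_mul_atTop hcθ))).const_mul C
    rw [mul_zero] at h2
    exact ((tendsto_order.1 h2).2 (1 / 2) (by norm_num)).mono fun k hk => hk.le
  filter_upwards [hgap, hluke, hR, hB, 𝔪.pairing_eq F, 𝔪.weight_dom F, ha1, hS1, hroom, hhalf, hM0] with k hgapk hlukek
    hRk hBk hpairk hdomk ha1k hS1k hroomk hhalfk hM0k
  -- notation at step `k`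
  obtain ⟨h2d, hpairk⟩ := hpairk
  set S : ℕ := sch.side k with hS_def
  set d : ℕ := 𝔪.depth F k with hd_def
  set a : ℝ := sch.a k with ha_def
  have ha0 : 0 < a := sch.a_pos k
  set t : ℕ := ⌈θ * (S : ℝ)⌉₊ with ht_def
  have htS : θ * (S : ℝ) ≤ (t : ℝ) := Nat.le_ceil _
  have htlt : (t : ℝ) < θ * S + 1 := Nat.ceil_lt_add_one (by positivity)
  have ht1 : 1 ≤ t := by
    have : (1 : ℝ) ≤ t := le_trans hS1k htS
    exact_mod_cast this
  have hS0 : (0 : ℝ) < S := by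
    have : (1 : ℝ) ≤ θ * S := hS1k
    nlinarith
  -- room: `2t + 2d ≤ S`, and the finer `2d + 2 ≤ cθ S`, `2 ≤ cθ S`
  have htd : 2 * t + 2 * d ≤ S := by
    have hreal : ((2 * t + 2 * d : ℕ) : ℝ) < (S : ℝ) := by
      push_cast
      have h1 : a * (2 * (t : ℝ) + 2 * d) < a * (2 * (θ * S + 1)) + 2 * R := by nlinarith
      have h2 : a * (2 * (θ * S + 1)) + 2 * R ≤ a * S := by nlinarith
      have h3 : a * (2 * (t : ℝ) + 2 * d) < a * S := lt_of_lt_of_le h1 h2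
      exact lt_of_mul_lt_mul_left h3 ha0.le
    exact_mod_cast hreal.le
  have hd2 : 2 * (d : ℝ) + 2 ≤ cθ * S := by
    have had : a * d ≤ R := hRk
    have h1 : a * (2 * (d : ℝ) + 2) ≤ 2 * R + 2 * a := by nlinarith
    have h2 : 2 * R + 2 * a ≤ a * (cθ * S) := by rw [hcθ_def]; nlinarith
    exact le_of_mul_le_mul_left (h1.trans h2) ha0
  -- the gap factor (torus-scale)
  set g : ℝ := Real.exp (-(M k / S)) with hg_def
  have hg0 : 0 ≤ g := (Real.exp_pos _).le
  have hμ0 : 0 ≤ M k / S := div_nonneg hM0k hS0.le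
  have hg1 : g ≤ 1 := by rw [hg_def, Real.exp_le_one_iff]; linarith
  have hsmg : ∀ j, 𝔪.sm k j ≤ g * 𝔪.top k := hgapk
  obtain ⟨W, hW⟩ := 𝔪.w_bdd F k
  -- `C ≥ 0`
  have hC0 : 0 ≤ C := by
    refine le_trans (add_nonneg (tsum_nonneg fun j => ?_) (tsum_nonneg fun j => ?_)) (hlukek t htS)
    · exact pow_nonneg (div_nonneg (𝔪.sp_nonneg k j) (𝔪.top_pos k).le) _
    · exact pow_nonneg (div_nonneg (𝔪.sm_nonneg k j) (𝔪.top_pos k).le) _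
  -- `g^n = exp(−(M/S) n)` and the exponent estimate `cθ M ≤ (M/S)·X` for `X ≥ cθ S`
  have hgpow : ∀ n : ℕ, g ^ n = Real.exp (-(M k / S * n)) := by
    intro n; rw [hg_def, ← Real.exp_nat_mul]; congr 1; ring
  have hexpX : ∀ X : ℝ, cθ * S ≤ X → Real.exp (-(M k / S * X)) ≤ Real.exp (-(cθ * M k)) := by
    intro X hX
    rw [Real.exp_le_exp]
    have h1 : M k / S * (cθ * S) ≤ M k / S * X := mul_le_mul_of_nonneg_left hX hμ0
    have h2 : M k / S * (cθ * S) = cθ * M k := by field_simp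
    linarith
  have hhalfk' : C * g ^ (S - 2 * t) ≤ 1 / 2 := by
    refine le_trans (mul_le_mul_of_nonneg_left ?_ hC0) hhalfk
    rw [hgpow]
    refine hexpX _ ?_
    have : ((S - 2 * t : ℕ) : ℝ) = S - 2 * t := by push_cast [show 2 * t ≤ S by omega]; ring
    rw [this]
    -- `S − 2t ≥ (1−2θ) S − 2 ≥ cθ S` because `cθ S ≥ 2`
    have hd0 : (0 : ℝ) ≤ 2 * (d : ℝ) := by positivity
    have h2 : (2 : ℝ) ≤ cθ * S := by linarith
    rw [hcθ_def] at h2 ⊢; nlinarith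
  -- sup bound
  set Bk : ℝ := K * a⁻¹ ^ P * (a * S) ^ Q with hBk_def
  -- apply the per-`k` core inequality
  have hcore := pairing_lower_bound (p := gramPairing r sch F k) (𝔪.top_pos k) (𝔪.sp_nonneg k) (𝔪.sm_nonneg k)
    (𝔪.sp_le k) (𝔪.sm_le k) hsmg hg0 (𝔪.summable_sp k) (𝔪.summable_sm k) (𝔪.wp_nonneg F k) (𝔪.wm_nonneg F k)
    hW (𝔪.exists_even_top k) ht1 htd (hlukek t htS)
    (by simpa only [mul_add, Nat.cast_add] using hlukek (t + d) (by push_cast; linarith))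
    hhalfk' hpairk (hdomk t Bk hBk)
  refine le_trans ?_ hcore
  -- `ε_k` dominates the per-`k` penalty
  have hexp : g ^ (S - 2 * d - 2 * t) ≤ Real.exp (-(cθ * M k)) := by
    rw [hgpow]
    refine hexpX _ ?_
    have : ((S - 2 * d - 2 * t : ℕ) : ℝ) = S - 2 * d - 2 * t := by
      rw [Nat.sub_sub, Nat.cast_sub (by omega)]; push_cast; ring
    rw [this]
    -- `S − 2d − 2t ≥ (1−2θ)S − 2d − 2 ≥ cθ S` because `2d + 2 ≤ cθ S` and `(1 − 2θ) S = 2 cθ S`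
    rw [hcθ_def] at hd2 ⊢; nlinarith
  have hBk2 : Bk ^ 2 = K ^ 2 * (a⁻¹ ^ (2 * P) * (a * S) ^ (2 * Q)) := by
    rw [hBk_def]; ring
  have hfinal : 2 * C * Bk ^ 2 * g ^ (S - 2 * d - 2 * t) ≤ ε k := by
    have hB2 : 0 ≤ 2 * C * Bk ^ 2 := by positivity
    calc 2 * C * Bk ^ 2 * g ^ (S - 2 * d - 2 * t)
        ≤ 2 * C * Bk ^ 2 * Real.exp (-(cθ * M k)) := mul_le_mul_of_nonneg_left hexp hB2
      _ = ε k := by simp only [ε, hBk2]; ring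
  linarith

/-- `OddTwistGap ⇒ OddLogGap` under `SideGrowth` (PROVED): take `M_k := γ a_k side_k`; `a_k side_k / log side_k → ∞` because
`log side_k = log(a_k side_k) + log a_k⁻¹` and both `x/log x → ∞`, `a_k L_k / log a_k⁻¹ → ∞` (`SideGrowth`). -/
theorem oddLogGap_of_oddTwistGap (𝔪 : DiagonalSliceModel r sch) (h : OddTwistGap 𝔪) (hside : SideGrowth sch) : OddLogGap 𝔪 := by
  obtain ⟨γ, hγ, hgap⟩ := h
  refine ⟨fun k => γ * (sch.a k * sch.side k), ?_, ?_⟩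
  · -- `γ · (a side) / log side → ∞`
    have hx := tendsto_a_mul_side' sch
    have h1 : Tendsto (fun k => sch.a k * (sch.side k : ℝ) / Real.log (sch.a k * sch.side k)) atTop atTop := by
      have := (tendsto_div_mul_log_atTop 1 one_pos).comp hx
      refine this.congr' (Eventually.of_forall fun k => ?_)
      simp [Function.comp]
    have h2 : Tendsto (fun k => sch.a k * (sch.side k : ℝ) / Real.log (sch.a k)⁻¹) atTop atTop := by
      -- `a side ≥ a L` and `SideGrowth : a L / log a⁻¹ → ∞`
      refine tendsto_atTop_mono' atTop ?_ hside
      have hl : ∀ᶠ k in atTop, 1 ≤ Real.log (sch.a k)⁻¹ := (tendsto_log_inv_a sch).eventually_ge_atTop 1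
      filter_upwards [hl] with k hl
      have hL : (sch.L k : ℝ) ≤ sch.side k := by
        have : (sch.side k : ℝ) = 2 * sch.L k + 1 := by simp [SpeciesScheme.side]
        rw [this]; linarith [(Nat.cast_nonneg (sch.L k) : (0 : ℝ) ≤ sch.L k)]
      exact div_le_div_of_nonneg_right (mul_le_mul_of_nonneg_left hL (sch.a_pos k).le) (by linarith)
    have hl1 : ∀ᶠ k in atTop, 1 ≤ Real.log (sch.a k * (sch.side k : ℝ)) :=
      (Real.tendsto_log_atTop.comp hx).eventually_ge_atTop 1
    have hl2 : ∀ᶠ k in atTop, 1 ≤ Real.log (sch.a k)⁻¹ := (tendsto_log_inv_a sch).eventually_ge_atTop 1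
    -- combine through `log side = log(a side) + log a⁻¹ ≤ 2 max(…)`
    have h3 : Tendsto (fun k => sch.a k * (sch.side k : ℝ) / Real.log (sch.side k)) atTop atTop := by
      refine tendsto_atTop.2 fun B => ?_
      filter_upwards [tendsto_atTop.1 h1 (2 * B), tendsto_atTop.1 h2 (2 * B), hl1, hl2, hx.eventually_ge_atTop 1]
        with k hB1 hB2 hl1 hl2 hu
      set u := sch.a k * (sch.side k : ℝ) with hu_def
      set p := Real.log (sch.a k * (sch.side k : ℝ)) with hp_def
      set q := Real.log (sch.a k)⁻¹ with hq_def
      have hsum : Real.log (sch.side k : ℝ) = p + q := by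
        have ha0 : sch.a k ≠ 0 := (sch.a_pos k).ne'
        have : (sch.side k : ℝ) = (sch.a k * sch.side k) * (sch.a k)⁻¹ := by field_simp
        rw [this, Real.log_mul (by positivity) (inv_ne_zero ha0)]
      rw [hsum]
      have hp : 0 < p := by linarith
      have hq : 0 < q := by linarith
      have hu0 : 0 ≤ u := by linarith
      rcases le_total p q with hpq | hpq
      · have hc : u / (2 * q) ≤ u / (p + q) := div_le_div_of_nonneg_left hu0 (by linarith) (by linarith)
        have hB : B ≤ u / (2 * q) := by rw [show u / (2 * q) = (u / q) / 2 by ring]; linarith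
        exact hB.trans hc
      · have hc : u / (2 * p) ≤ u / (p + q) := div_le_div_of_nonneg_left hu0 (by linarith) (by linarith)
        have hB : B ≤ u / (2 * p) := by rw [show u / (2 * p) = (u / p) / 2 by ring]; linarith
        exact hB.trans hc
    refine (h3.const_mul_atTop hγ).congr' (Eventually.of_forall fun k => ?_)
    simp only; ring
  · filter_upwards [hgap] with k hk j
    have : -(γ * (sch.a k * sch.side k) / sch.side k) = -(γ * sch.a k) := by
      have hS0 : (sch.side k : ℝ) ≠ 0 := by
        have : 0 < sch.side k := by simp [SpeciesScheme.side]
        exact_mod_cast this.ne'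
      field_simp
    rw [this]; exact hk j

/-- The two routes meet (PROVED): a super-logarithmic `CoarseGap` ALONE (no clustering, no visibility) already gives the retyped letter
`OddLogGap` — so §2's bridge is the statement that everything ABOVE the torus scale is soft, and §3 is the statement that the core needs
nothing above it; door B's R1-side residue is exactly the torus-scale band. -/
theorem oddLogGap_of_coarseGap {𝔪 : DiagonalSliceModel r sch} (𝔭 : TwoShiftProbes 𝔪) {M : ℕ → ℝ}
    (hM : Tendsto (fun k => M k / Real.log (sch.side k)) atTop atTop) (hgap : CoarseGap 𝔭 M) : OddLogGap 𝔪 := by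
  refine ⟨M, hM, ?_⟩
  filter_upwards [hgap, 𝔭.r_spec_odd] with k hk hodd j
  exact (hodd j).trans (mul_le_mul_of_nonneg_right hk (𝔪.top_pos k).le)

/-- Door-B packaging with the retyped R1: `(∃ 𝔪, OddLogGap 𝔪 ∧ DiagLukewarm 𝔪) → Growth → D1′-socket` (PROVED). -/
theorem oddTorusSwapPairingLiminf_of_logGapLetters
    (h : ∃ 𝔪 : DiagonalSliceModel r sch, OddLogGap 𝔪 ∧ DiagLukewarm 𝔪) (hG : Growth r sch) :
    OddTorusSwapPairingLiminf r sch := by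
  obtain ⟨𝔪, h1, h2⟩ := h
  exact core_of_logGap 𝔪 h1 h2 hG

end LogGap

end Summit.QuantumFields.YangMills.Cruxes.DiagonalMirrorRPR.SignTwistedDiagonalTrace

end
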